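import Summits.BirchSwinnertonDyer.BirchSwinnertonDyer.Theses.ResidualThetaTransportAtTwo
import Summits.BirchSwinnertonDyer.BirchSwinnertonDyer.Theorems.ThetaPartnerAtTwoSignedMainConjectureCMTwoRankZeroTorsionOfPoitouTate
import Summits.BirchSwinnertonDyer.BirchSwinnertonDyer.Theorems.ThetaPartnerAtTwoSignedControlAtTwoStubPoitouTateShaRat
import Summits.BirchSwinnertonDyer.BirchSwinnertonDyer.Theorems.ThetaPartnerAtTwoSignedControlAtTwoStubPoitouTateSelmerRat
import Summits.BirchSwinnertonDyer.BirchSwinnertonDyer.Theorems.ThetaPartnerAtTwoSignedControlAtTwoShaThreeSylowField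
import Summits.BirchSwinnertonDyer.BirchSwinnertonDyer.Theorems.ThetaPartnerAtTwoSignedControlAtTwoShaThreeBaseH3Units
import Literature.NumberTheory.GaloisCohomology.PoitouTateTwoRealPlacesSurjectiveHolds
import Summits.BirchSwinnertonDyer.BirchSwinnertonDyer.Theorems.ResidualThetaTransportAtTwoSignedMuVanishingAtTwoPlusLineV42
import HarnessLib

/-!
# Crux Kμ⁺ `SignedMuVanishingAtTwoPlus` (stmt-BirchSwinnertonDyer-20689): the TORSION clause of its algebraic conjunct is a
# theorem modulo Gross–Zagier–Kolyvagin; the residue of conjunct 1 is the μ-clause alone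

Cell `bsd-wall`, lead `bsd-wall-rtt-p4` g8 (helper, `--supports stmt-BirchSwinnertonDyer-20689`; THEOREMS ONLY — no `def`, no
named fact, no `sorry`). BSD is not proved by this.

Conjunct 1 of the crux reads: for every habitat⁺ curve `W`, every cyclotomic `ℤ₂`-extension `κ` with topological generator `γ`
and every `+` signed Selmer dual datum `D` with `D.X` finitely generated over `Λ = ℤ₂⟦T⟧`, «`D.X` is `Λ`-torsion ∧ `μ(D.X) = 0`».
Since crux K4 `SignedControlAtTwo` landed (lead tp2-p3 g6, p630337) the four generic Poitou–Tate rows over `ℚ` are TREE THEOREMS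
(`SignedEC.PoitouTateSelmerRat.stub_poitouTateSelmerRat` (4.10(b)), `SignedEC.PoitouTateShaRat.stub_poitouTateShaRat` (4.10(a)),
`SignedEC.ShaThree.poitouTate_three_realPlaces_injective_of_base` + `SignedEC.ShaThreeBrauer.stub_realThreeOrderTwoBase` (4.10(c)₃),
`Literature.NumberTheory.GaloisCohomology.poitouTate_two_realPlaces_surjective_holds` (Cor. 4.16)), and the aside seat
bsd-inputs-k4-p1 proved `SignedEC.TorsionPT.signedTorsionTwoRankZero_of_poitouTate`: GZK + the four rows ⟹ `X⁺(A/ℚ_∞)` is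
`Λ`-torsion for every globally minimal `A/ℚ` of analytic rank `0`, good supersingular at `2` with `a₂ = 0` (Kobayashi Thm. 1.2
shape at `p = 2`: `Sel_{2^∞}(A/ℚ)` finite by GZK, Kim's signed `Γ`-Euler characteristic at `2` makes `Sel⁺(A/ℚ_∞)^γ` finite,
Greenberg's Lemma 4.2 shape gives torsion). This file discharges the four rows and records the consequence for Kμ⁺:

* `muAlgebraic_iff_mu_eq_zero_of_GZK` — granted GZK, conjunct 1 of Kμ⁺ (verbatim) ⟺ its μ-clause «`D.mu = 0`» alone (the
  torsion clause being `signedTorsionTwoRankZero_of_poitouTate` with the four rows discharged INLINE; the stand-alone door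
  «torsion ⟸ GZK» / «torsion ⟸ Sel finite» is filed by the K4 width seat tp2-p3-w3 g10 as
  `SignedEC.TorsionPT.signedTorsionTwoRankZero_of_gzk` / `signedTorsionTwo_of_finiteSelmer` (announced 12:15:55Z) and is
  deliberately NOT re-declared here);
* `signedMuSeedAtTwoPlus_iff_mu_eq_zero_of_GZK` — granted GZK, the seed item 21438 ⟺ the same μ-clause (through the landed
  `muAlgebraic_iff_signedMuSeedAtTwoPlus`, p585569);
* `signedMuVanishingAtTwoPlus_iff_analytic_and_mu_eq_zero_of_GZK` — granted GZK, Kμ⁺ ⟺ 21437 ∧ (μ-clause).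

HONEST FRAMING: GZK (Gross–Zagier–Kolyvagin: rank = analytic rank and `Ш` finite for `r_an ≤ 1`) is an unproved print fact of the
tree, taken by name; the μ-clause (`μ(X⁺(W/ℚ_∞)) = 0` at `2` for every habitat⁺ curve — Greenberg's Conj. 1.11 in the signed
setting at `2`; by the crux-ideate memo SEED-FINE-HALF-CUBIC-MU-k1g8 its fine half is Iwasawa's `μ₂ = 0` for the cubic
2-division field) is NOT proved here and remains the research residue of the crux. BSD is not proved by any of this.

References: [Kobayashi2003] Thm. 1.2; [BDKim2013] Cor. 3.15; [GreenbergLNM1716] §4 Lemma 4.2, Conj. 1.11; [MilneADT2006] I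
Thm. 4.10, Cor. 4.16; [Kolyvagin1990] Thm. A; [GrossZagier1986] Thm. I.6.3.
-/

set_option autoImplicit false
-- justification: the `Summit.BirchSwinnertonDyer.BirchSwinnertonDyer.…` path repeats a component (route-file convention)
set_option linter.dupNamespace false

noncomputable section

open scoped Classical

open WeierstrassCurve Literature.NumberTheory.EllipticCurves Literature.NumberTheory.EllipticCurves.Rank1Residual
  Literature.NumberTheory.EllipticCurves.Kobayashi2003 ZpExtension
  Summit.BirchSwinnertonDyer.BirchSwinnertonDyer.Theses.ResidualThetaTransportAtTwo

namespace Summit.BirchSwinnertonDyer.BirchSwinnertonDyer.Theorems.SignedMuAtTwo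

/-- **Granted GZK, conjunct 1 of Kμ⁺ (verbatim: torsion ∧ `μ = 0` for every finitely generated `+` datum on the habitat⁺) is
EQUIVALENT to its μ-clause alone** — the torsion clause holds for EVERY `+` datum of every analytic-rank-`0` curve of the `a₂ = 0` supersingular row by `SignedEC.TorsionPT.signedTorsionTwoRankZero_of_poitouTate` (Kobayashi Thm. 1.2 shape at `2`: `Sel_{2^∞}` finite by GZK, Kim's signed `Γ`-Euler characteristic, Greenberg's Lemma 4.2), whose four Poitou–Tate rows over `ℚ` are tree theorems since K4 landed. So the research residue of the algebraic half
of the crux is exactly «`μ(X⁺(W/ℚ_∞)) = 0` at `2` on the habitat⁺» (Greenberg's Conj. 1.11 in the signed setting at `2`).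
BSD is not proved by this. [cite: GreenbergLNM1716, Conj. 1.11] [cite: Kobayashi2003, Thm. 1.2] -/
theorem muAlgebraic_iff_mu_eq_zero_of_GZK (hGZK : rank_eq_analyticRank_of_analyticRank_le_one) :
    (∀ (W : WeierstrassCurve ℚ) [W.IsElliptic] [W.IsGloballyMinimal], ¬ W.HasCM → W.analyticRank = 0 →
        GoodSS W 2 → W.frobeniusTrace 2 = 0 → W.Δ < 0 →
        ∀ (κ : ZpExtension ℚ 2) (γ : Field.absoluteGaloisGroup ℚ), κ.IsCyclotomic → κ.IsTopGenerator γ →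
        ∀ (D : SignedSelmerDualData W κ γ 1) [Module.Finite (IwasawaAlgebra 2) D.X],
          Module.IsTorsion (IwasawaAlgebra 2) D.X ∧ D.mu = 0) ↔
      (∀ (W : WeierstrassCurve ℚ) [W.IsElliptic] [W.IsGloballyMinimal], ¬ W.HasCM → W.analyticRank = 0 →
        GoodSS W 2 → W.frobeniusTrace 2 = 0 → W.Δ < 0 →
        ∀ (κ : ZpExtension ℚ 2) (γ : Field.absoluteGaloisGroup ℚ), κ.IsCyclotomic → κ.IsTopGenerator γ →
        ∀ (D : SignedSelmerDualData W κ γ 1) [Module.Finite (IwasawaAlgebra 2) D.X], D.mu = 0) := by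
  constructor
  · intro h W _ _ hCM hr hss ha hΔ κ γ hκ hγ D _
    exact (h W hCM hr hss ha hΔ κ γ hκ hγ D).2
  · intro h W _ _ hCM hr hss ha hΔ κ γ hκ hγ D _
    -- torsion: k4-p1's `signedTorsionTwoRankZero_of_poitouTate` with the four Poitou–Tate rows over `ℚ` discharged by the
    -- K4 lineage's tree theorems (PT(b) p625615, PT(a) p629917, 4.10(c)₃ p628282 + p622411, 4.16 p618871)
    exact ⟨SignedEC.TorsionPT.signedTorsionTwoRankZero_of_poitouTate hGZK
        SignedEC.PoitouTateSelmerRat.stub_poitouTateSelmerRat SignedEC.PoitouTateShaRat.stub_poitouTateShaRat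
        (SignedEC.ShaThree.poitouTate_three_realPlaces_injective_of_base ℚ
          SignedEC.ShaThreeBrauer.stub_realThreeOrderTwoBase
          Literature.NumberTheory.GaloisCohomology.poitouTate_two_realPlaces_surjective_holds)
        (Literature.NumberTheory.GaloisCohomology.poitouTate_two_realPlaces_surjective_holds ℚ)
        W hr hss ha κ γ hκ hγ D,
      h W hCM hr hss ha hΔ κ γ hκ hγ D⟩

/-- **Granted GZK, the μ-seed item 21438 `SignedMuSeedAtTwoPlus` is EQUIVALENT to the μ-clause** «`μ(X⁺(W/ℚ_∞)) = 0` at `2`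
for every finitely generated `+` datum of every habitat⁺ curve» (through `muAlgebraic_iff_signedMuSeedAtTwoPlus`, p585569:
the seed IS conjunct 1, `A := W` and the proved propagation at `2`). BSD is not proved by this.
[cite: GreenbergLNM1716, Conj. 1.11] [cite: Kobayashi2003, Thm. 1.2] -/
theorem signedMuSeedAtTwoPlus_iff_mu_eq_zero_of_GZK (hGZK : rank_eq_analyticRank_of_analyticRank_le_one) :
    SignedMuSeedAtTwoPlus ↔
      (∀ (W : WeierstrassCurve ℚ) [W.IsElliptic] [W.IsGloballyMinimal], ¬ W.HasCM → W.analyticRank = 0 →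
        GoodSS W 2 → W.frobeniusTrace 2 = 0 → W.Δ < 0 →
        ∀ (κ : ZpExtension ℚ 2) (γ : Field.absoluteGaloisGroup ℚ), κ.IsCyclotomic → κ.IsTopGenerator γ →
        ∀ (D : SignedSelmerDualData W κ γ 1) [Module.Finite (IwasawaAlgebra 2) D.X], D.mu = 0) :=
  muAlgebraic_iff_signedMuSeedAtTwoPlus.symm.trans (muAlgebraic_iff_mu_eq_zero_of_GZK hGZK)

/-- **Granted GZK, the crux Kμ⁺ ⟺ (analytic child 21437) ∧ (μ-clause)** — `signedMuVanishingAtTwoPlus_iff_analytic_and_seed`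
(p585569) with the seed replaced by the μ-clause. The two research residues of the crux are therefore: `μ(L♭_f) = 0`
(21437, ⟸ node 27436 / Artin (AP₃), `…LineV46`/`…LineV47`) and `μ(X⁺) = 0` at `2` (algebraic). BSD is not proved by this.
[cite: GreenbergLNM1716, Conj. 1.11] [cite: Pollack2003, Conj. 6.3] -/
theorem signedMuVanishingAtTwoPlus_iff_analytic_and_mu_eq_zero_of_GZK (hGZK : rank_eq_analyticRank_of_analyticRank_le_one) :
    SignedMuVanishingAtTwoPlus ↔
      SignedMuAnalyticAtTwoPlus ∧
        (∀ (W : WeierstrassCurve ℚ) [W.IsElliptic] [W.IsGloballyMinimal], ¬ W.HasCM → W.analyticRank = 0 →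
          GoodSS W 2 → W.frobeniusTrace 2 = 0 → W.Δ < 0 →
          ∀ (κ : ZpExtension ℚ 2) (γ : Field.absoluteGaloisGroup ℚ), κ.IsCyclotomic → κ.IsTopGenerator γ →
          ∀ (D : SignedSelmerDualData W κ γ 1) [Module.Finite (IwasawaAlgebra 2) D.X], D.mu = 0) :=
  signedMuVanishingAtTwoPlus_iff_analytic_and_seed.trans
    (and_congr_right fun _ ↦ signedMuSeedAtTwoPlus_iff_mu_eq_zero_of_GZK hGZK)

end Summit.BirchSwinnertonDyer.BirchSwinnertonDyer.Theorems.SignedMuAtTwo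

end
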